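import Summits.BirchSwinnertonDyer.Rank1Residual.Additive.ShaCardSignedTwistRankOneDefect
import Summits.BirchSwinnertonDyer.Rank1Residual.Additive.SignedTwistOddBranchReadings
import HarnessLib

/-!
# THE SELMER SIDE OF (C3_η) IN RANK ONE WITH THE KITAJIMA–OTSUKI INPUT IN ITS PRINTED SHAPE:
# `#Ш(W)[p^∞] · p^{2ν} · ∏_{ℓ ∈ T} p^{ord_p c_ℓ(W)} = p^{ord_p f(0)}` from `hPT` + the TYPED READING (R2)
# (equivalently the VERBATIM SHAPE of Kitajima–Otsuki 2018 Main Thm. 1.3, sign `−`, `η`-part, via the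
# cell's dictionary theorem) + `Ш(W)[p^∞]` finite + the rank-one generator + `T`
# (cell `b2b-bsdres`, CLASS-CLOSURE lane, class O10 — x1b GEN 44, class lead; file 122 of the series)

HONEST FRAMING (cell `b2b-bsdres`, run/shared/lean/b2b/bsd-rank1-residual/, verbatim in every
file): the goal of the cell is to DELETE the COMBINATION-SHAPED residual classes of the
Birch–Swinnerton-Dyer formula for ALL analytic-rank `≤ 1` elliptic curves over `ℚ` — "full BSD
formula for every rank `≤ 1` curve in class `C`" assembled STRICTLY from published theorems — so
that the rank-`≤ 1` remainder becomes exactly the CONSTRUCTION-SHAPED classes, which are TYPED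
(missing-input `Prop`s), NOT attempted. This is not "finishing BSD". CLASS-CLOSURE lane: prove
what is provable now; shrink each hard class to its core with data; no claim beyond stated classes;
research routes on CONSTRUCTION-SHAPED X12 / O10; census / instrument output = EVIDENCE / conjecture
items, NEVER a Literature fact; `RESIDUAL-MAP.md` marks change only by signed lines. THIS FILE:
TOOL THEOREMS ONLY — no definition, no named Literature fact, no Summits-side fact `def … : Prop`,
no `sorry`, axioms standard; CONDITIONAL on: the NAMED FACT `poitouTate_selmerStructure_duality_real ℚ`
(`hPT`); the cell's TYPED INPUT (R2) `OddBranchStrictMinusNoFiniteSubmoduleAt W p` (p17,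
`QuadraticBranchOddStrictSelmerReadings.lean`; the READING of Kitajima–Otsuki 2018 Main Thm. 1.3, sign
`−`, through the `η`-twist dictionary — NOT a Literature fact, NOT asserted) resp. the VERBATIM SHAPE
`hKO` of that theorem on cc-typer-6's `η`-part object (hypothesis text `HKO p`, flag `KO18-eta-summand`;
the Literature fact awaits the promotion of the `ℚ(μ_{p^∞})`-tower vocabulary, events 6916077 / 6916103);
and the displayed rank-one inputs (`Ш(W)[p^∞]` finite — Gross–Zagier–Kolyvagin in the application; a
generator modulo torsion of exact level `ν`). Nothing is booked; no label / mark / count / sub-cell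
moves; nothing about (C1_η), (C2_η-GZ), (C3_η) as typed, or `BSD(W, p)` of any pair, is claimed.

## What

For the `(−1)^{p/2}p`-twist `W` (globally minimal, `p`-integral) of a globally minimal `V/ℚ` with good
reduction at the odd prime `p`, `a_p(V) = 0`, `κ` cyclotomic with topological generator `γ`, EVERY
strict-minus dual datum `D` of `Sel^{−,str}(W/ℚ_∞)` at the model `ℚ_[p]` with `char(X) = (f)`:

* `card_sha_mul_eq_pow_of_oddBranchNoFiniteSubmodule_of_quadraticTwist_signedPrime_rankOne`:
  (R2) ⟹ **`#Ш(W)[p^∞] · (p^{2ν} · ∏_{ℓ ∈ T} p^{ord_p c_ℓ(W)}) = p^{ord_p f(0)}`** — (R2)'s displayed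
  hypotheses "`X` f.g. and torsion" are THEOREMS in rank one (file 118), so (R2) delivers `hnf` and
  file 121 (`…_iff_invariants_eq_bot`, `hnf ⟹ X[T] = 0`) the formula;
* `card_sha_mul_eq_pow_of_kitajimaOtsuki13MinusEta_of_quadraticTwist_signedPrime_rankOne`: the same
  from the VERBATIM SHAPE `hKO` (cc-typer-6's text `HKO p`), through the cell's dictionary theorem
  `SignedTwist.oddBranchStrictMinusNoFiniteSubmoduleAt_of_kitajimaOtsuki13MinusEta` (file P5-5b).

* §2 (intrinsic) `exists_generator_and_level_of_mordellWeilRank_eq_one` (Mordell–Weil + AEC VII.6.3: a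
  generator modulo torsion and its exact level exist when `rank W(ℚ) = 1`), hence
  `exists_card_localPreimage_eq_card_sha_mul_of_mordellWeilRank_eq_one` and
  `exists_pow_constantCoeff_mul_natCard_invariants_eq_of_mordellWeilRank_eq_one`: file 121's two
  formulas with `∃ ν` for EVERY rank-one `W` with `Ш(W)[p^∞]` finite (NO `hnf`, NO per-pair datum but `T`).

NET after GEN 44: the Selmer side of (C3_η) for the pair `(W, p)` has inputs EXACTLY: `hPT` (named fact,
Milne I 4.10 / Howard 2.1.11), `hKO` (printed theorem in its verbatim shape on the tree's `η`-part object;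
Kobayashi Thm. 2.2 supplies its torsion clause in print for `F = ℚ`), `Ш(W)[p^∞]` finite, the rank-one
generator with its level `ν`, and `T`. What `BSD_p(W)` still needs: (C1_η) and (C2_η-GZ) — typed, not
claimed.

References: [GreenbergLNM1716] §4 Thm. 4.1, Lemma 4.2 (p. 102); [Kobayashi2003] Thm. 2.2 (p. 5), §4 (p. 8),
Thm. 9.3 (p. 26); [KitajimaOtsuki2018] Main Thm. 1.3 (= Thm. 4.8) with Def. 2.1 (arXiv:1607.03612 pp. 3, 6);
[MilneADT2006] I Thm. 4.10.
-/

noncomputable section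

open scoped Classical

open CategoryTheory Field Function NumberField IsDedekindDomain WeierstrassCurve
open Literature.NumberTheory.EllipticCurves
open Literature.NumberTheory.GaloisRepresentations
open Literature.NumberTheory.GaloisCohomology
open Literature.NumberTheory.EllipticCurves.Kobayashi2003
open Literature.NumberTheory.EllipticCurves.IwasawaAlgebra
open Literature.NumberTheory.EllipticCurves.IwasawaDual
open Summit.BirchSwinnertonDyer.Rank1Residual.X11b

-- Over `ℚ` two `ℚ`-algebra structures on a completion are in scope; the general-`K` statements must be
-- met by the completion's own (the device of files 78, 107, 108, 118, 120, 121).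
attribute [local instance 10000] IsDedekindDomain.HeightOneSpectrum.instAlgebraAdicCompletion
  NumberField.Place.instAlgebraCompletion

namespace Summit.BirchSwinnertonDyer.Rank1Residual.Additive.LevelBridge

variable (W : WeierstrassCurve ℚ) [W.IsElliptic] {p : ℕ} [hp : Fact p.Prime]
  (κ : ZpExtension ℚ p) [hint : (W.baseChange ℚ_[p]).IsIntegral ℤ_[p]]

section RankOne

variable [W.IsGloballyMinimal]
    (hp2 : p ≠ 2) (hκ : κ.IsCyclotomic) (Cv : VariableChange ℚ) (V : WeierstrassCurve ℚ)
    [V.IsElliptic] [V.IsGloballyMinimal] (hCV : Cv • W.quadraticTwist ((-1) ^ (p / 2) * p) = V)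
    (hgood : V.HasGoodReductionAtPrime p) (hap : V.frobeniusTrace p = 0)
    (hPT : poitouTate_selmerStructure_duality_real ℚ)
    (P : W.toAffine.Point) (hP : ¬ IsOfFinAddOrder P)
    (hgen : ∀ R : W.toAffine.Point, ∃ (k : ℤ) (T : W.toAffine.Point), IsOfFinAddOrder T ∧ R = k • P + T)
    {ν : ℕ}
    (hdiv : ∃ Q : (W.baseChange ℚ_[p]).toAffine.Point,
      p ^ ν • Q = Affine.Point.baseChange (W' := W) ℚ ℚ_[p] P)
    (hndiv : ∀ Q : (W.baseChange ℚ_[p]).toAffine.Point,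
      p ^ (ν + 1) • Q ≠ Affine.Point.baseChange (W' := W) ℚ ℚ_[p] P)
    [hSha : Finite (AddCommGroup.primaryComponent W.sha p)]
    (T : Finset (HeightOneSpectrum (𝓞 ℚ)))
    (hpT : (Rat.HeightOneSpectrum.primesEquiv (R := 𝓞 ℚ)).symm ⟨p, hp.out⟩ ∉ T)
    (hT : ∀ v : HeightOneSpectrum (𝓞 ℚ), v ≠ (Rat.HeightOneSpectrum.primesEquiv (R := 𝓞 ℚ)).symm ⟨p, hp.out⟩ →
      p ∣ (W.baseChange (v.adicCompletion ℚ)).localTamagawaNumber (v.adicCompletionIntegers ℚ) → v ∈ T)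
    {γ : absoluteGaloisGroup ℚ} (hγ : κ.IsTopGenerator γ) (D : StrictSignedSelmerDualData W κ ℚ_[p] γ (-1))
    {f : IwasawaAlgebra p} (hf : D.charIdeal = Ideal.span {f})

include hp2 hκ hCV hgood hap hPT hP hgen hdiv hndiv hSha hpT hT hγ hf

/-- **(R2) ⟹ `#Ш(W)[p^∞] · (p^{2ν} · ∏_{ℓ ∈ T} p^{ord_p c_ℓ(W)}) = p^{ord_p f(0)}` in rank one.** The cell's
typed input (R2) `OddBranchStrictMinusNoFiniteSubmoduleAt W p` (READING of Kitajima–Otsuki 2018 Main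
Thm. 1.3, sign `−`, through the `η`-twist dictionary; NOT asserted) gives, for every strict-minus dual
datum whose module is f.g. and torsion, the absence of finite `Λ`-submodules; in rank one "f.g. and
torsion" are THEOREMS (file 118, given `hPT` + `Ш(W)[p^∞]` finite), so (R2) supplies `hnf` and file 121
the exact formula. CONDITIONAL on `hPT` and (R2); nothing about (C1_η), (C2_η-GZ), (C3_η) as typed, or
`BSD(W, p)`, is claimed; nothing booked. [cite: KitajimaOtsuki2018, Main Thm. 1.3 (= Thm. 4.8) with Def. 2.1 (arXiv:1607.03612 pp. 3, 6)]
[cite: GreenbergLNM1716, §4 Thm. 4.1 and Lemma 4.2 (p. 102)] [cite: MilneADT2006, Ch. I, Thm. 4.10] -/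
theorem card_sha_mul_eq_pow_of_oddBranchNoFiniteSubmodule_of_quadraticTwist_signedPrime_rankOne
    (hR2 : OddBranchStrictMinusNoFiniteSubmoduleAt W p) :
    Nat.card (AddCommGroup.primaryComponent W.sha p) *
        (p ^ (2 * ν) * ∏ w ∈ T, p ^ padicValNat p ((W.baseChange (w.adicCompletion ℚ)).localTamagawaNumber
          (w.adicCompletionIntegers ℚ))) =
      p ^ (((PowerSeries.constantCoeff f : ℤ_[p]) : ℚ_[p]).valuation).toNat := by
  refine card_sha_mul_eq_pow_of_noFiniteSubmodule_of_quadraticTwist_signedPrime_rankOne W κ hp2 hκ Cv V hCV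
    hgood hap hPT P hP hgen hdiv hndiv T hpT hT hγ D (fun N hN ↦ ?_) hf
  obtain ⟨Q, hPQ⟩ := hdiv
  obtain ⟨hMF, hX, -⟩ := isTorsion_and_constantCoeff_ne_zero_of_quadraticTwist_signedPrime_rankOne W κ hp2
    hκ Cv V hCV hgood hap hPT P hP hgen hPQ hndiv T hpT hT hγ D
  exact hR2 V Cv hp2 hCV hgood hap κ γ hκ hγ D hMF hX N hN

/-- **The VERBATIM SHAPE of Kitajima–Otsuki 2018 Main Thm. 1.3 (sign `−`, `η`-part) ⟹
`#Ш(W)[p^∞] · (p^{2ν} · ∏_{ℓ ∈ T} p^{ord_p c_ℓ(W)}) = p^{ord_p f(0)}` in rank one.** Hypothesis `hKO` is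
EXACTLY cc-typer-6's text `HKO p` (the printed theorem for `F = F' = ℚ` on the `η`-summand
`X⁻(V/ℚ(μ_{p^∞}))^η`, flag `KO18-eta-summand`; its torsion clause (vi) is Kobayashi Thm. 2.2 in print
for `F = ℚ`); the cell's dictionary theorem (file P5-5b,
`SignedTwist.oddBranchStrictMinusNoFiniteSubmoduleAt_of_kitajimaOtsuki13MinusEta`) turns it into (R2),
and the previous theorem applies. So the Selmer side of (C3_η) for the pair has inputs EXACTLY
`hPT` + `hKO` + `Ш(W)[p^∞]` finite + the rank-one generator of level `ν` + `T`. NOTHING about the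
printed theorem is asserted here; nothing about (C1_η), (C2_η-GZ), (C3_η) as typed, or `BSD(W, p)`, is
claimed; nothing booked. [cite: KitajimaOtsuki2018, Main Thm. 1.3 (= Thm. 4.8) with Def. 2.1 (arXiv:1607.03612 pp. 3, 6)]
[cite: Kobayashi2003, Thm. 2.2 (p. 5), §4 p. 8] [cite: GreenbergLNM1716, §4 Thm. 4.1 and Lemma 4.2 (p. 102)] -/
theorem card_sha_mul_eq_pow_of_kitajimaOtsuki13MinusEta_of_quadraticTwist_signedPrime_rankOne
    (hKO : ∀ (K₀ : Type) [Field K₀] [NumberField K₀] [IsCyclotomicExtension {p} ℚ K₀]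
        [(galRange (K := ℚ) K₀).Normal] (η : absoluteGaloisGroup ℚ →* ℤˣ),
        (∀ σ ∈ galRange (K := ℚ) K₀, η σ = 1) →
      ∀ (V : WeierstrassCurve ℚ) [V.IsElliptic] [V.IsGloballyMinimal],
        p ≠ 2 → V.HasGoodReductionAtPrime p → V.frobeniusTrace p = 0 →
      ∀ (κ : ZpExtension ℚ p) (γ : absoluteGaloisGroup ℚ),
        κ.IsCyclotomic → κ.IsTopGenerator γ → γ ∈ galRange (K := ℚ) K₀ →
      ∀ (D : EtaSignedSelmerDualData V κ K₀ ℚ_[p] η γ (-1)),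
        Module.Finite (IwasawaAlgebra p) D.X → Module.IsTorsion (IwasawaAlgebra p) D.X →
        ∀ M : Submodule (IwasawaAlgebra p) D.X, Finite M → M = ⊥) :
    Nat.card (AddCommGroup.primaryComponent W.sha p) *
        (p ^ (2 * ν) * ∏ w ∈ T, p ^ padicValNat p ((W.baseChange (w.adicCompletion ℚ)).localTamagawaNumber
          (w.adicCompletionIntegers ℚ))) =
      p ^ (((PowerSeries.constantCoeff f : ℤ_[p]) : ℚ_[p]).valuation).toNat :=
  card_sha_mul_eq_pow_of_oddBranchNoFiniteSubmodule_of_quadraticTwist_signedPrime_rankOne W κ hp2 hκ Cv V hCV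
    hgood hap hPT P hP hgen hdiv hndiv T hpT hT hγ D hf
    (SignedTwist.oddBranchStrictMinusNoFiniteSubmoduleAt_of_kitajimaOtsuki13MinusEta W p hKO)

end RankOne

/-! ## §2 Intrinsic form: Mordell–Weil rank one, the generator and its level produced inside -/

section Intrinsic

omit hint in
/-- **The rank-one data exist**: for `W` of Mordell–Weil rank one (the `p*`-twist of a good `a_p = 0`
curve, `p` odd) there are a generator `P` of `W(ℚ)` modulo torsion and its EXACT `p`-divisibility level
`ν` in `W(ℚ_p)` — Mordell–Weil (`exists_generator_of_mordellWeilRank_eq_one`) and AEC VII.6.3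
(`StrictSha.exists_level_of_not_isOfFinAddOrder`, `W(ℚ_p) → ℤ_p` vanishing exactly on torsion).
[cite: SilvermanAEC2009, Prop. VII.6.3 and Thm. VIII.6.7] -/
theorem exists_generator_and_level_of_mordellWeilRank_eq_one (hrank : W.mordellWeilRank = 1) :
    ∃ (P : W.toAffine.Point) (ν : ℕ), ¬ IsOfFinAddOrder P ∧
      (∀ R : W.toAffine.Point, ∃ (k : ℤ) (T : W.toAffine.Point), IsOfFinAddOrder T ∧ R = k • P + T) ∧
      (∃ Q : (W.baseChange ℚ_[p]).toAffine.Point, p ^ ν • Q = Affine.Point.baseChange (W' := W) ℚ ℚ_[p] P) ∧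
      ∀ Q : (W.baseChange ℚ_[p]).toAffine.Point,
        p ^ (ν + 1) • Q ≠ Affine.Point.baseChange (W' := W) ℚ ℚ_[p] P := by
  obtain ⟨P, hP, hgen⟩ := exists_generator_of_mordellWeilRank_eq_one W hrank
  obtain ⟨lam, hlam⟩ := exists_addMonoidHom_padicInt_apply_eq_zero_iff p (W.baseChange ℚ_[p])
  have hinj : Function.Injective (W.toPadicPoint p) :=
    Affine.Point.map_injective (W' := W) (Algebra.ofId ℚ ℚ_[p])
  -- (`hP`, `hgen` carry the classical `DecidableEq ℚ` of the general lemma; `convert` re-instances)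
  have hP' : ¬ IsOfFinAddOrder P := by convert hP
  have hPp : ¬ IsOfFinAddOrder (W.toPadicPoint p P) := by
    intro h
    apply hP'
    obtain ⟨m, hm, hmP⟩ := isOfFinAddOrder_iff_nsmul_eq_zero.mp h
    refine isOfFinAddOrder_iff_nsmul_eq_zero.mpr ⟨m, hm, hinj ?_⟩
    rw [map_nsmul, map_zero]
    exact hmP
  obtain ⟨ν, hdiv, hndiv⟩ := StrictSha.exists_level_of_not_isOfFinAddOrder p lam hlam hPp
  refine ⟨P, ν, hP', fun R ↦ ?_, hdiv, hndiv⟩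
  obtain ⟨a, t, ht, hR⟩ := hgen R
  exact ⟨a, t, by convert ht, by convert hR⟩

variable
    (hp2 : p ≠ 2) (hκ : κ.IsCyclotomic) (Cv : VariableChange ℚ) (V : WeierstrassCurve ℚ)
    [V.IsElliptic] [V.IsGloballyMinimal] (hCV : Cv • W.quadraticTwist ((-1) ^ (p / 2) * p) = V)
    (hgood : V.HasGoodReductionAtPrime p) (hap : V.frobeniusTrace p = 0)
    (hPT : poitouTate_selmerStructure_duality_real ℚ)
    (hrank : W.mordellWeilRank = 1)
    [hSha : Finite (AddCommGroup.primaryComponent W.sha p)]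
    (T : Finset (HeightOneSpectrum (𝓞 ℚ)))
    (hpT : (Rat.HeightOneSpectrum.primesEquiv (R := 𝓞 ℚ)).symm ⟨p, hp.out⟩ ∉ T)
    (hT : ∀ v : HeightOneSpectrum (𝓞 ℚ), v ≠ (Rat.HeightOneSpectrum.primesEquiv (R := 𝓞 ℚ)).symm ⟨p, hp.out⟩ →
      p ∣ (W.baseChange (v.adicCompletion ℚ)).localTamagawaNumber (v.adicCompletionIntegers ℚ) → v ∈ T)

include hp2 hκ hCV hgood hap hPT hrank hSha hpT hT

/-- **INTRINSIC FORM, NO dual datum, NO `hnf`: for the `p*`-twist `W` of Mordell–Weil rank ONE with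
`Ш(W)[p^∞]` finite there is `ν` (the level of a generator) with
`#Sel^{loc,∞}(W/ℚ) = #Ш(W)[p^∞] · (p^{2ν} · ∏_{ℓ ∈ T} p^{ord_p c_ℓ(W)})`**, given `hPT` and any admissible
`T` — file 121's `card_localPreimage_eq_card_sha_mul_…` with the generator and its level produced by the
previous theorem. CONDITIONAL on `hPT`; nothing about (C1_η), (C2_η-GZ), (C3_η), `BSD(W, p)` claimed;
nothing booked. [cite: GreenbergLNM1716, §3 (pp. 85–90), §4 Thm. 4.1] [cite: MilneADT2006, Ch. I, Thm. 4.10] -/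
theorem exists_card_localPreimage_eq_card_sha_mul_of_mordellWeilRank_eq_one :
    ∃ ν : ℕ, Nat.card ↥((W.selmerInfty κ ⊓ ⨅ σ : absoluteGaloisGroup ℚ,
        (localKummerOverOfEmb W p κ.kerSubgroup (closureEmb (K := ℚ) ℚ_[p])
          (⨆ n, strictSignedLocalPoints κ ℚ_[p] W (-1) n)).comap
            (W.conjH1 p κ.kerSubgroup σ)).comap (W.layerToInfty κ 0)) =
      Nat.card (AddCommGroup.primaryComponent W.sha p) *
        (p ^ (2 * ν) * ∏ w ∈ T, p ^ padicValNat p ((W.baseChange (w.adicCompletion ℚ)).localTamagawaNumber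
          (w.adicCompletionIntegers ℚ))) := by
  obtain ⟨P, ν, hP, hgen, hdiv, hndiv⟩ := exists_generator_and_level_of_mordellWeilRank_eq_one W (p := p) hrank
  exact ⟨ν, card_localPreimage_eq_card_sha_mul_of_quadraticTwist_signedPrime_rankOne W κ hp2 hκ Cv V hCV hgood hap
    hPT P hP hgen hdiv hndiv T hpT hT⟩

/-- **INTRINSIC FORM with the defect: for `W` of rank one with `Ш(W)[p^∞]` finite, `γ` a topological
generator and EVERY strict-minus dual datum `D` with `char(X) = (f)` there is `ν` with
`p^{ord_p f(0)} · #X[T] = #Ш(W)[p^∞] · (p^{2ν} · ∏_{ℓ ∈ T} p^{ord_p c_ℓ(W)})`** — hence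
`ord_p f(0) ≤ ord_p #Ш(W)[p^∞] + 2ν + ∑_{ℓ∈T} ord_p c_ℓ(W)` with NO no-finite-submodule input, and equality
iff `X[T] = 0` (file 121). CONDITIONAL on `hPT`; nothing about (C1_η), (C2_η-GZ), (C3_η), `BSD(W, p)`
claimed; nothing booked. [cite: GreenbergLNM1716, §4 Thm. 4.1 and Lemma 4.2 (p. 102)] [cite: MilneADT2006, Ch. I, Thm. 4.10] -/
theorem exists_pow_constantCoeff_mul_natCard_invariants_eq_of_mordellWeilRank_eq_one
    {γ : absoluteGaloisGroup ℚ} (hγ : κ.IsTopGenerator γ) (D : StrictSignedSelmerDualData W κ ℚ_[p] γ (-1))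
    {f : IwasawaAlgebra p} (hf : D.charIdeal = Ideal.span {f}) :
    ∃ ν : ℕ, p ^ (((PowerSeries.constantCoeff f : ℤ_[p]) : ℚ_[p]).valuation).toNat * Nat.card (invariants p D.X) =
      Nat.card (AddCommGroup.primaryComponent W.sha p) *
        (p ^ (2 * ν) * ∏ w ∈ T, p ^ padicValNat p ((W.baseChange (w.adicCompletion ℚ)).localTamagawaNumber
          (w.adicCompletionIntegers ℚ))) := by
  obtain ⟨P, ν, hP, hgen, hdiv, hndiv⟩ := exists_generator_and_level_of_mordellWeilRank_eq_one W (p := p) hrank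
  exact ⟨ν, pow_constantCoeff_mul_natCard_invariants_eq_card_sha_mul_of_quadraticTwist_signedPrime_rankOne W κ hp2
    hκ Cv V hCV hgood hap hPT P hP hgen hdiv hndiv T hpT hT hγ D hf⟩

end Intrinsic

end Summit.BirchSwinnertonDyer.Rank1Residual.Additive.LevelBridge

end
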